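import Summits.ValiantsHypothesis.ValiantsHypothesis.Theorems.SymPencilEquivariantSdcNotQPAnticommutingPairs
import Summits.ValiantsHypothesis.ValiantsHypothesis.Theorems.SymPencilEquivariantSdcNotQPProjectiveCoxeterNormalization
import Literature.RepresentationTheory.FiniteGroups.SymmetricGroupCoxeterPresentation
import HarnessLib

/-!
# ValiantsHypothesis / SymPencil — crux `EquivariantSdcNotQP` (stmt-ValiantsHypothesis-17792), line
# `birth_EquivariantSdcNotQP`, stub `stub_permify`: the spin dichotomy for projective
# representations of the symmetric group

Helper of the item (`--supports stmt-ValiantsHypothesis-17792 --as helper`; 0 definitions, 0 named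
facts).  **`projective_perm_dichotomy`** (Schur 1911, `M(𝔖_n) = ℤ/2` with the degree bound for
spin representations, in the crude form sufficient for the line): let `φ : G ↠ 𝔖_n` be a
surjection of groups and `ρ : G →* GL_k(ℂ)`, `k ≥ 1`, a representation that is SCALAR on `ker φ`
(i.e. a projective representation of `𝔖_n`).  Then EITHER `n ≤ 4 (log₂ k + 1)`, OR there is a
GENUINE representation `ρ₁ : 𝔖_n →* GL_k(ℂ)` with `ρ(g) ∈ ℂˣ · ρ₁(φ g)` for all `g ∈ G` (the
projective representation is equivalent to a linear one).

Proof: lifts `P_r = ρ(g_r)` of the adjacent transpositions `s_r = (r, r+1)` satisfy the Coxeter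
relations up to the scalars `ρ(w)`, `w ∈ ker φ` a Coxeter relator word; Schur's normalisation
(`coxeter_normalization`, `…ProjectiveCoxeterNormalization.lean`) rescales them to `T_r` with
exact squares and braids and far pairs all commuting or all anticommuting.  Anticommuting ⇒
`n ≤ 4 (log₂ k + 1)` (`le_log_of_anticommuting_involutions`, `…AnticommutingPairs.lean`);
commuting ⇒ the `T_r` are Coxeter data of type `A_{n-1}` and the tree's universal property of
`𝔖_n` (`Literature.RepresentationTheory.FiniteGroups.permFinLift`, Björner–Brenti Prop. 1.5.4)
gives `ρ₁` with `ρ₁(s_r) = T_r`; `ρ(g) ∈ ℂˣ ρ₁(φ g)` follows by induction over the adjacent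
transpositions (`Equiv.Perm.mclosure_swap_castSucc_succ`).

Honest framing: a classical theorem about `𝔖_n`; `stub_permify`, the crux
`SymPencil.EquivariantSdcNotQP` and `VP ≠ VNP` remain OPEN and nothing here is progress on them.
-/

noncomputable section

set_option linter.dupNamespace false

namespace Summit.ValiantsHypothesis.ValiantsHypothesis.Theorems.SymPencilEquivariantSdcNotQP.SpinDichotomy

open Matrix Equiv Literature.RepresentationTheory.FiniteGroups

/-- In a monoid, involutions `a`, `b` with the braid relation have `(ab)³ = 1`. [folklore] -/
theorem cube_eq_one_of_braid {M : Type*} [Monoid M] {a b : M} (ha : a * a = 1) (hb : b * b = 1)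
    (h : a * b * a = b * a * b) : a * b * (a * b) * (a * b) = 1 := by
  calc a * b * (a * b) * (a * b) = (a * b * a) * b * a * b := by simp only [mul_assoc]
    _ = b * a * (b * b) * a * b := by rw [h]; simp only [mul_assoc]
    _ = 1 := by rw [hb, mul_one, mul_assoc b a a, ha, mul_one, hb]

/-- In a monoid, commuting involutions `a`, `b` have `(ab)² = 1`. [folklore] -/
theorem sq_eq_one_of_comm {M : Type*} [Monoid M] {a b : M} (ha : a * a = 1) (hb : b * b = 1)
    (h : a * b = b * a) : a * b * (a * b) = 1 := by
  calc a * b * (a * b) = a * (b * a) * b := by simp only [mul_assoc]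
    _ = a * (a * b) * b := by rw [← h]
    _ = (a * a) * (b * b) := by simp only [mul_assoc]
    _ = 1 := by rw [ha, hb, one_mul]

variable {G : Type*} [Group G] {n k : ℕ}

/-- A unit of `M_k(ℂ)`, `k ≥ 1`, that is a scalar matrix has a nonzero scalar. [folklore] -/
theorem scalar_ne_zero_of_unit (hk : 1 ≤ k) (u : GL (Fin k) ℂ) {c : ℂ}
    (h : (u : Matrix (Fin k) (Fin k) ℂ) = c • (1 : Matrix (Fin k) (Fin k) ℂ)) : c ≠ 0 := by
  haveI : Nonempty (Fin k) := ⟨⟨0, hk⟩⟩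
  intro hc
  rw [hc, zero_smul] at h
  exact Units.ne_zero u h

/-- **The spin dichotomy for projective representations of `𝔖_n`** (Schur 1911).  For a
surjection `φ : G ↠ 𝔖_n` and a representation `ρ : G →* GL_k(ℂ)`, `k ≥ 1`, scalar on `ker φ`:
either `n ≤ 4 (log₂ k + 1)`, or `ρ` is projectively equivalent to a genuine representation
`ρ₁ : 𝔖_n →* GL_k(ℂ)` — `ρ(g) = c_g ρ₁(φ g)`, `c_g ∈ ℂˣ`. [folklore] -/
theorem projective_perm_dichotomy (hk : 1 ≤ k) (φ : G →* Perm (Fin n))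
    (ρ : G →* GL (Fin k) ℂ)
    (hφ : Function.Surjective φ)
    (hker : ∀ g : G, φ g = 1 → ∃ c : ℂ,
      (ρ g : Matrix (Fin k) (Fin k) ℂ) = c • (1 : Matrix (Fin k) (Fin k) ℂ)) :
    n ≤ 4 * (Nat.log 2 k + 1) ∨
      ∃ ρ₁ : Perm (Fin n) →* GL (Fin k) ℂ, ∀ g : G, ∃ c : ℂ, c ≠ 0 ∧
        (ρ g : Matrix (Fin k) (Fin k) ℂ) =
          c • (ρ₁ (φ g) : Matrix (Fin k) (Fin k) ℂ) := by
  classical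
  have hS := isCoxeterDataA_adjSwap n
  -- lifts of the adjacent transpositions
  obtain ⟨g, hg⟩ : ∃ g : ℕ → G, ∀ r, φ (g r) = adjSwap n r :=
    ⟨fun r => (hφ (adjSwap n r)).choose, fun r => (hφ (adjSwap n r)).choose_spec⟩
  set P : ℕ → Matrix (Fin k) (Fin k) ℂ := fun r => (ρ (g r) : Matrix (Fin k) (Fin k) ℂ)
    with hP
  have hPmul : ∀ r t, P r * P t = (ρ (g r * g t) : Matrix (Fin k) (Fin k) ℂ) := fun r t => by
    rw [map_mul, Units.val_mul]
  -- the Coxeter relations up to scalars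
  have hsq : ∀ r, r + 1 < n →
      ∃ c : ℂ, c ≠ 0 ∧ P r * P r = c • (1 : Matrix (Fin k) (Fin k) ℂ) := by
    intro r hr
    have h1 : φ (g r * g r) = 1 := by rw [map_mul, hg, hS.sq r hr]
    obtain ⟨c, hc⟩ := hker _ h1
    exact ⟨c, scalar_ne_zero_of_unit hk _ hc, by rw [hPmul, hc]⟩
  have hcube : ∀ r, r + 2 < n → ∃ c : ℂ,
      P r * P (r + 1) * (P r * P (r + 1)) * (P r * P (r + 1)) =
        c • (1 : Matrix (Fin k) (Fin k) ℂ) := by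
    intro r hr
    have h1 : φ (g r * g (r + 1) * (g r * g (r + 1)) * (g r * g (r + 1))) = 1 := by
      simp only [map_mul, hg]
      exact cube_eq_one_of_braid (hS.sq r (by omega)) (hS.sq (r + 1) hr) (hS.braid r hr)
    obtain ⟨c, hc⟩ := hker _ h1
    refine ⟨c, ?_⟩
    rw [← hc]
    simp only [hP, map_mul, Units.val_mul]
  have hfar : ∀ r t, t + 1 < n → r + 2 ≤ t → ∃ c : ℂ,
      P r * P t * (P r * P t) = c • (1 : Matrix (Fin k) (Fin k) ℂ) := by
    intro r t ht hrt
    have h1 : φ (g r * g t * (g r * g t)) = 1 := by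
      simp only [map_mul, hg]
      exact sq_eq_one_of_comm (hS.sq r (by omega)) (hS.sq t ht) (hS.comm r t ht (by omega))
    obtain ⟨c, hc⟩ := hker _ h1
    refine ⟨c, ?_⟩
    rw [← hc]
    simp only [hP, map_mul, Units.val_mul]
  -- Schur's normalisation
  obtain ⟨a, ha0, hTsq, hTbraid, hcomm | hanti⟩ := coxeter_normalization hk P hsq hcube hfar
  swap
  · -- anticommuting far pairs: the degree is large
    exact Or.inl (le_log_of_anticommuting_involutions (fun r => a r • P r) hk hTsq hanti)
  -- commuting far pairs: a genuine representation of `𝔖_n`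
  right
  have hData : IsCoxeterDataA n (fun r => a r • P r) :=
    { sq := hTsq
      braid := hTbraid
      comm := fun r t ht hrt => hcomm r t ht (by omega) }
  set ρM : Perm (Fin n) →* Matrix (Fin k) (Fin k) ℂ := permFinLift hData with hρM
  have hρM_adj : ∀ r, r + 1 < n → ρM (adjSwap n r) = a r • P r := fun r hr =>
    permFinLift_adjSwap hData hr
  refine ⟨ρM.toHomUnits, ?_⟩
  -- `ρ g ∈ ℂˣ ρM (φ g)`, by induction over the adjacent transpositions
  suffices key : ∀ (x : Perm (Fin n)) (g₀ : G), φ g₀ = x → ∃ c : ℂ, c ≠ 0 ∧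
      (ρ g₀ : Matrix (Fin k) (Fin k) ℂ) = c • ρM x by
    intro g₀
    obtain ⟨c, hc0, hc⟩ := key (φ g₀) g₀ rfl
    exact ⟨c, hc0, by rw [MonoidHom.coe_toHomUnits, hc]⟩
  -- the three closure steps
  have hone : ∀ g₀ : G, φ g₀ = 1 → ∃ c : ℂ, c ≠ 0 ∧
      (ρ g₀ : Matrix (Fin k) (Fin k) ℂ) = c • ρM 1 := by
    intro g₀ hg₀
    obtain ⟨c, hc⟩ := hker g₀ hg₀
    exact ⟨c, scalar_ne_zero_of_unit hk _ hc, by rw [map_one, hc]⟩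
  have hmul : ∀ x y : Perm (Fin n),
      (∀ g₀ : G, φ g₀ = x → ∃ c : ℂ, c ≠ 0 ∧
        (ρ g₀ : Matrix (Fin k) (Fin k) ℂ) = c • ρM x) →
      (∀ g₀ : G, φ g₀ = y → ∃ c : ℂ, c ≠ 0 ∧
        (ρ g₀ : Matrix (Fin k) (Fin k) ℂ) = c • ρM y) →
      ∀ g₀ : G, φ g₀ = x * y → ∃ c : ℂ, c ≠ 0 ∧
        (ρ g₀ : Matrix (Fin k) (Fin k) ℂ) = c • ρM (x * y) := by
    intro x y hx hy g₀ hg₀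
    obtain ⟨gx, hgx⟩ := hφ x
    have hgy : φ (gx⁻¹ * g₀) = y := by rw [map_mul, map_inv, hgx, hg₀, inv_mul_cancel_left]
    obtain ⟨c, hc0, hc⟩ := hx gx hgx
    obtain ⟨c', hc0', hc'⟩ := hy _ hgy
    refine ⟨c * c', mul_ne_zero hc0 hc0', ?_⟩
    have e : g₀ = gx * (gx⁻¹ * g₀) := by rw [mul_inv_cancel_left]
    rw [e, map_mul, Units.val_mul, hc, hc', map_mul, Matrix.smul_mul, Matrix.mul_smul, smul_smul]
  have hgen : ∀ r, r + 1 < n → ∀ g₀ : G, φ g₀ = adjSwap n r → ∃ c : ℂ, c ≠ 0 ∧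
      (ρ g₀ : Matrix (Fin k) (Fin k) ℂ) = c • ρM (adjSwap n r) := by
    intro r hr g₀ hg₀
    have h1 : φ ((g r)⁻¹ * g₀) = 1 := by rw [map_mul, map_inv, hg, hg₀, inv_mul_cancel]
    obtain ⟨c, hc⟩ := hker _ h1
    have hc0 := scalar_ne_zero_of_unit hk _ hc
    refine ⟨c * (a r)⁻¹, mul_ne_zero hc0 (inv_ne_zero (ha0 r hr)), ?_⟩
    have e : g₀ = g r * ((g r)⁻¹ * g₀) := by rw [mul_inv_cancel_left]
    rw [e, map_mul, Units.val_mul, hc, hρM_adj r hr, Matrix.mul_smul, Matrix.mul_one, smul_smul,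
      mul_assoc, inv_mul_cancel₀ (ha0 r hr), mul_one]
  -- closure induction
  cases n with
  | zero =>
    intro x g₀ hg₀
    rw [Subsingleton.elim x 1] at hg₀ ⊢
    exact hone g₀ hg₀
  | succ m =>
    intro x
    have hx : x ∈ Submonoid.closure (Set.range fun i : Fin m => swap i.castSucc i.succ) := by
      rw [Equiv.Perm.mclosure_swap_castSucc_succ m]; exact Submonoid.mem_top x
    induction hx using Submonoid.closure_induction with
    | mem y hy =>
      obtain ⟨i, rfl⟩ := hy
      intro g₀ hg₀
      beta_reduce at hg₀ ⊢
      rw [swap_castSucc_succ_eq_adjSwap] at hg₀ ⊢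
      exact hgen i (by have := i.2; omega) g₀ hg₀
    | one => exact hone
    | mul y z _ _ hy hz => exact hmul y z hy hz

end Summit.ValiantsHypothesis.ValiantsHypothesis.Theorems.SymPencilEquivariantSdcNotQP.SpinDichotomy

end
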